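import Summits.BirchSwinnertonDyer.BirchSwinnertonDyer.Theorems.KolyvaginRoadThreePTDescentLocalData
import Literature.NumberTheory.GaloisRepresentations.LocalGlobalCohomologyTateProofs
import HarnessLib

/-!
# The local corestriction data of the prime-to-`p` descent, DUAL SIDE: `Hom(M, μₚ(K̄))|_{Γ_{K'}} ≅
# Hom(M, μₚ(K̄'))`, `Cor^D`, `Cor^D_{w/v}`, and the (unramified) binder for the duals

Route `KolyvaginRoadThree`, crux `ZhangSharpFrameAtThreeHL` (stmt-BirchSwinnertonDyer-19574), PT road
(C) (`PT-ROAD-DESIGN-g19.md` §2).  Milne I 4.10(b) over `K'` (the hypothesis `hE'` of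
`middleExact_canonical_of_descentData`) speaks of the Tate dual `(M|_{Γ_{K'}})^D = Hom(M, μₚ(K̄'))`,
whereas the corestriction of the dual module `M^D = Hom(M, μₚ(K̄))` lands in `H¹(K, M^D)`.  The two
`Γ_{K'}`-modules are isomorphic through the chosen `K̄ → K̄'` (`muTransfer`): `κ f = ι ∘ f`
(`dualKappa`, with inverse `dualKappaInv`; NO conjugator globally).  This file defines the dual data of the
descent — `CorGD := Cor_{K'/K} ∘ H¹(κ)⁻¹` (`globalCorDual`) and
`Cor^D_{w/v} := localCor (ρ^D) ∘ H¹(κ|_{Γ_{K'_w}})⁻¹` (`localCorDual`) — and proves the binder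
(unramified) for them (`localCorDual_mem_unramifiedSubgroup`).  Definitions with bodies and theorems;
no named fact; no case of BSD.

References: [MilneADT2006] I §0 (`M^D`), §2; [SerreGaloisCohomology1997] I §2.4.
-/

noncomputable section

open CategoryTheory Function NumberField IsDedekindDomain
open scoped NumberField ContRepresentation Classical

set_option linter.dupNamespace false
set_option autoImplicit false

namespace Summit.BirchSwinnertonDyer.BirchSwinnertonDyer.Theorems.KolyvaginRoadThreePT

open Field
open Literature.NumberTheory.GaloisRepresentations Literature.NumberTheory.GaloisCohomology
open Literature.NumberTheory.GaloisRepresentations.DiscreteGaloisModule (mu MuCarrier TateDual tateDual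
  unramifiedSubgroup)
open Literature.NumberTheory.GaloisRepresentations.SemiLocal (Place algebraPlace)

section Dual

variable {K K' : Type} [Field K] [NumberField K] [Field K'] [NumberField K'] [Algebra K K']
variable {M : Type} [AddCommGroup M] [TopologicalSpace M] [DiscreteTopology M] [Finite M]
variable {p : ℕ} [NeZero p] (ρ : DiscreteGaloisModule K M)

/-! ## `κ : Hom(M, μₚ(K̄))|_{Γ_{K'}} ≅ Hom(M, μₚ(K̄'))` -/

/-- `κ` on elements: `f ↦ ι ∘ f`. [cite: MilneADT2006, Ch. I §0 (M^D)] -/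
def dualKappaFun (f : TateDual K M p) : TateDual K' M p :=
  (muTransfer K K' p).comp
    { toFun := fun m => (f m : MuCarrier K p)
      map_zero' := map_zero f
      map_add' := map_add f }

omit [NumberField K] [NumberField K'] [TopologicalSpace M] [DiscreteTopology M] [Finite M] [NeZero p] in
/-- Unfolding `dualKappaFun`. [cite: MilneADT2006, Ch. I §0 (M^D)] -/
@[simp]
theorem dualKappaFun_apply (f : TateDual K M p) (m : M) :
    dualKappaFun (K' := K') f m = muTransfer K K' p (f m : MuCarrier K p) := rfl

/-- `κ⁻¹` on elements: `f' ↦ ι⁻¹ ∘ f'`. [cite: MilneADT2006, Ch. I §0 (M^D)] -/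
def dualKappaInvFun (f : TateDual K' M p) : TateDual K M p :=
  ((muTransferEquiv K K' p).symm.toAddMonoidHom).comp
    { toFun := fun m => (f m : MuCarrier K' p)
      map_zero' := map_zero f
      map_add' := map_add f }

omit [TopologicalSpace M] [DiscreteTopology M] [Finite M] in
/-- Unfolding `dualKappaInvFun`. [cite: MilneADT2006, Ch. I §0 (M^D)] -/
@[simp]
theorem dualKappaInvFun_apply (f : TateDual K' M p) (m : M) :
    dualKappaInvFun (K := K) f m = (muTransferEquiv K K' p).symm (f m : MuCarrier K' p) := rfl

/-- `κ` as an additive homomorphism. [cite: MilneADT2006, Ch. I §0 (M^D)] -/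
def dualKappaAddHom : TateDual K M p →+ TateDual K' M p where
  toFun := dualKappaFun
  map_zero' := DiscreteGaloisModule.TateDual.ext fun m => by
    rw [dualKappaFun_apply, DiscreteGaloisModule.TateDual.zero_apply, DiscreteGaloisModule.TateDual.zero_apply]
    exact map_zero (muTransfer K K' p)
  map_add' f g := DiscreteGaloisModule.TateDual.ext fun m => by
    rw [dualKappaFun_apply, DiscreteGaloisModule.TateDual.add_apply, DiscreteGaloisModule.TateDual.add_apply,
      dualKappaFun_apply, dualKappaFun_apply]
    exact map_add (muTransfer K K' p) _ _

/-- `κ⁻¹` as an additive homomorphism. [cite: MilneADT2006, Ch. I §0 (M^D)] -/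
def dualKappaInvAddHom : TateDual K' M p →+ TateDual K M p where
  toFun := dualKappaInvFun
  map_zero' := DiscreteGaloisModule.TateDual.ext fun m => by
    rw [dualKappaInvFun_apply, DiscreteGaloisModule.TateDual.zero_apply, DiscreteGaloisModule.TateDual.zero_apply]
    exact map_zero (muTransferEquiv K K' p).symm
  map_add' f g := DiscreteGaloisModule.TateDual.ext fun m => by
    rw [dualKappaInvFun_apply, DiscreteGaloisModule.TateDual.add_apply, DiscreteGaloisModule.TateDual.add_apply,
      dualKappaInvFun_apply, dualKappaInvFun_apply]
    exact map_add (muTransferEquiv K K' p).symm _ _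

/-- **`κ f = ι ∘ f`**: the `Γ_{K'}`-intertwining map from the restricted dual `(M^D)|_{Γ_{K'}}`
(`Hom(M, μₚ(K̄))`) to the dual of the restriction `(M|_{Γ_{K'}})^D` (`Hom(M, μₚ(K̄'))`), through the
chosen embedding `ι : K̄ → K̄'` on roots of unity (`muTransfer`, equivariant by `muTransfer_mu`).
[cite: MilneADT2006, Ch. I §0 (M^D)] -/
def dualKappa :
    ((ρ.tateDual p).restrictField K').toContRepresentation →ⁱL
      (tateDual (ρ.restrictField K') p).toContRepresentation where
  toContinuousLinearMap := ⟨(dualKappaAddHom (K := K) (K' := K') (p := p)).toIntLinearMap,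
    continuous_of_discreteTopology⟩
  isIntertwining' s := ContinuousLinearMap.ext fun f => by
    refine DiscreteGaloisModule.TateDual.ext fun m => ?_
    change dualKappaFun (((ρ.tateDual p).restrictField K') s f) m =
      (tateDual (ρ.restrictField K') p) s (dualKappaFun f) m
    simp only [dualKappaFun_apply, GaloisRep.restrictField_apply, DiscreteGaloisModule.tateDual_apply_apply_apply,
      muTransfer_mu, map_inv (absGaloisRestrict K K') s]

omit [NumberField K] [NumberField K'] [NeZero p] in
/-- Unfolding `dualKappa`: `κ f m = ι (f m)`. [cite: MilneADT2006, Ch. I §0 (M^D)] -/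
@[simp]
theorem dualKappa_apply_apply (f : TateDual K M p) (m : M) :
    dualKappa (K' := K') (p := p) ρ f m = muTransfer K K' p (f m : MuCarrier K p) := rfl

/-- **`κ⁻¹ f' = ι⁻¹ ∘ f'`** (the chosen `K̄ → K̄'` is bijective on roots of unity, `muTransferEquiv`).
[cite: MilneADT2006, Ch. I §0 (M^D)] -/
def dualKappaInv :
    (tateDual (ρ.restrictField K') p).toContRepresentation →ⁱL
      ((ρ.tateDual p).restrictField K').toContRepresentation where
  toContinuousLinearMap := ⟨(dualKappaInvAddHom (K := K) (K' := K') (p := p)).toIntLinearMap,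
    continuous_of_discreteTopology⟩
  isIntertwining' s := ContinuousLinearMap.ext fun f => by
    refine DiscreteGaloisModule.TateDual.ext fun m => ?_
    change dualKappaInvFun ((tateDual (ρ.restrictField K') p) s f) m =
      (((ρ.tateDual p).restrictField K') s (dualKappaInvFun f)) m
    apply (muTransferEquiv K K' p).injective
    simp only [dualKappaInvFun_apply, AddEquiv.apply_symm_apply, GaloisRep.restrictField_apply,
      DiscreteGaloisModule.tateDual_apply_apply_apply, muTransferEquiv_apply, muTransfer_mu,
      map_inv (absGaloisRestrict K K') s]
    rw [← muTransferEquiv_apply, AddEquiv.apply_symm_apply]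

/-- Unfolding `dualKappaInv`: `κ⁻¹ f' m = ι⁻¹ (f' m)`. [cite: MilneADT2006, Ch. I §0 (M^D)] -/
@[simp]
theorem dualKappaInv_apply_apply (f : TateDual K' M p) (m : M) :
    dualKappaInv (K' := K') (p := p) ρ f m = (muTransferEquiv K K' p).symm (f m : MuCarrier K' p) := rfl

/-- `κ⁻¹ (κ f) = f`. [cite: MilneADT2006, Ch. I §0 (M^D)] -/
theorem dualKappaInv_dualKappa (f : TateDual K M p) :
    dualKappaInv (K' := K') (p := p) ρ (dualKappa ρ f) = f := by
  refine DiscreteGaloisModule.TateDual.ext fun m => ?_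
  rw [dualKappaInv_apply_apply, dualKappa_apply_apply, ← muTransferEquiv_apply, AddEquiv.symm_apply_apply]

/-- `κ (κ⁻¹ f') = f'`. [cite: MilneADT2006, Ch. I §0 (M^D)] -/
theorem dualKappa_dualKappaInv (f : TateDual K' M p) :
    dualKappa (K' := K') (p := p) ρ (dualKappaInv ρ f) = f := by
  refine DiscreteGaloisModule.TateDual.ext fun m => ?_
  rw [dualKappa_apply_apply, dualKappaInv_apply_apply, ← muTransferEquiv_apply, AddEquiv.apply_symm_apply]

/-! ## The induced isomorphisms on `H¹`, globally and at a place `w` of `K'` -/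

/-- **`H¹(K', (M^D)|_{Γ_{K'}}) ≃+ H¹(K', (M|_{Γ_{K'}})^D)`** induced by `κ`.
[cite: SerreGaloisCohomology1997, I §2.4] -/
def dualTransfer :
    galoisCohomology ((ρ.tateDual p).restrictField K') 1 ≃+ galoisCohomology (tateDual (ρ.restrictField K') p) 1 where
  toFun := galoisCohomology.map (dualKappa ρ) 1
  invFun := galoisCohomology.map (dualKappaInv ρ) 1
  left_inv y := galoisCohomology.map_one_map_one_eq_self_of_comp_eq _ _ (dualKappaInv_dualKappa ρ) y
  right_inv y := galoisCohomology.map_one_map_one_eq_self_of_comp_eq _ _ (dualKappa_dualKappaInv ρ) y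
  map_add' := map_add _

variable (v : HeightOneSpectrum (𝓞 K)) (w : Place K K' v)

/-- **The local version at `w`**: `H¹(K'_w, (M^D)|) ≃+ H¹(K'_w, (M|_{Γ_{K'}})^D|)` induced by
`κ|_{Γ_{K'_w}}` (`ContIntertwiningMap.restrictField`). [cite: SerreGaloisCohomology1997, I §2.4] -/
def dualTransferLocal :
    galoisCohomology (((ρ.tateDual p).restrictField K').restrictField ((w : HeightOneSpectrum (𝓞 K')).adicCompletion K')) 1 ≃+
      galoisCohomology ((tateDual (ρ.restrictField K') p).restrictField ((w : HeightOneSpectrum (𝓞 K')).adicCompletion K')) 1 where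
  toFun := galoisCohomology.map ((dualKappa ρ).restrictField ((w : HeightOneSpectrum (𝓞 K')).adicCompletion K')) 1
  invFun := galoisCohomology.map ((dualKappaInv ρ).restrictField ((w : HeightOneSpectrum (𝓞 K')).adicCompletion K')) 1
  left_inv y := galoisCohomology.map_one_map_one_eq_self_of_comp_eq
    ((dualKappa ρ).restrictField ((w : HeightOneSpectrum (𝓞 K')).adicCompletion K'))
    ((dualKappaInv ρ).restrictField ((w : HeightOneSpectrum (𝓞 K')).adicCompletion K'))
    (fun f => by
      rw [ContIntertwiningMap.restrictField_apply, ContIntertwiningMap.restrictField_apply]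
      exact dualKappaInv_dualKappa (K' := K') (p := p) ρ f) y
  right_inv y := galoisCohomology.map_one_map_one_eq_self_of_comp_eq
    ((dualKappaInv ρ).restrictField ((w : HeightOneSpectrum (𝓞 K')).adicCompletion K'))
    ((dualKappa ρ).restrictField ((w : HeightOneSpectrum (𝓞 K')).adicCompletion K'))
    (fun f => by
      rw [ContIntertwiningMap.restrictField_apply, ContIntertwiningMap.restrictField_apply]
      exact dualKappa_dualKappaInv (K' := K') (p := p) ρ f) y
  map_add' := map_add _

/-- Unfolding `dualTransferLocal.symm`. [cite: SerreGaloisCohomology1997, I §2.4] -/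
theorem dualTransferLocal_symm_apply
    (z : galoisCohomology ((tateDual (ρ.restrictField K') p).restrictField ((w : HeightOneSpectrum (𝓞 K')).adicCompletion K')) 1) :
    (dualTransferLocal (p := p) ρ v w).symm z =
      galoisCohomology.map ((dualKappaInv ρ).restrictField ((w : HeightOneSpectrum (𝓞 K')).adicCompletion K')) 1 z :=
  rfl

/-! ## `Cor^D` and `Cor^D_{w/v}` -/

/-- **`Cor^D : H¹(K', (M|_{Γ_{K'}})^D) →+ H¹(K, M^D)`** — the corestriction of the dual module after
`H¹(κ)⁻¹` (the datum `CorGD` of `middleExact_canonical_of_descentData` for `ρ' = ρ|_{Γ_{K'}}`).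
[cite: SerreGaloisCohomology1997, I §2.4] -/
def globalCorDual : galoisCohomology (tateDual (ρ.restrictField K') p) 1 →+ galoisCohomology (ρ.tateDual p) 1 := by
  haveI : FiniteDimensional K K' := Module.Finite.of_restrictScalars_finite ℚ K K'
  exact (galoisCohomology.cor (ρ.tateDual p) K').comp (dualTransfer (p := p) ρ).symm.toAddMonoidHom

/-- **`Cor^D_{w/v} : H¹(K'_w, (M|_{Γ_{K'}})^D) →+ H¹(K_v, M^D)`** — `localCor` of the dual module after
`H¹(κ|_{Γ_{K'_w}})⁻¹` (the datum `CorD v w` of `middleExact_canonical_of_descentData`).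
[cite: SerreGaloisCohomology1997, I §2.4] -/
def localCorDual :
    galoisCohomology ((tateDual (ρ.restrictField K') p).restrictField ((w : HeightOneSpectrum (𝓞 K')).adicCompletion K')) 1 →+
      galoisCohomology (GaloisRep.toLocal v (ρ.tateDual p)) 1 :=
  (localCor v w (ρ.tateDual p)).comp (dualTransferLocal (p := p) ρ v w).symm.toAddMonoidHom

/-- Unfolding `localCorDual`. [cite: SerreGaloisCohomology1997, I §2.4] -/
theorem localCorDual_apply
    (z : galoisCohomology ((tateDual (ρ.restrictField K') p).restrictField ((w : HeightOneSpectrum (𝓞 K')).adicCompletion K')) 1) :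
    localCorDual (p := p) ρ v w z = localCor v w (ρ.tateDual p) ((dualTransferLocal (p := p) ρ v w).symm z) := rfl

/-! ## (unramified) for the duals -/

/-- **(unramified, dual side) `Cor^D_{w/v}` maps `H¹_ur(K'_w, (M|_{Γ_{K'}})^D)` into `H¹_ur(K_v, M^D)`**
(`H¹(κ⁻¹|)` is induced by an intertwining map, `galoisCohomology.res_map_one`; then
`localCor_mem_unramifiedSubgroup` for the dual module). [cite: MilneADT2006, Ch. I §2 (unramified cohomology)] -/
theorem localCorDual_mem_unramifiedSubgroup
    (z : galoisCohomology ((tateDual (ρ.restrictField K') p).restrictField ((w : HeightOneSpectrum (𝓞 K')).adicCompletion K')) 1)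
    (hz : z ∈ unramifiedSubgroup
      (GaloisRep.toLocal (w : HeightOneSpectrum (𝓞 K')) (tateDual (ρ.restrictField K') p)) 1) :
    localCorDual (p := p) ρ v w z ∈ unramifiedSubgroup (GaloisRep.toLocal v (ρ.tateDual p)) 1 := by
  rw [localCorDual_apply, dualTransferLocal_symm_apply]
  refine localCor_mem_unramifiedSubgroup v w (ρ.tateDual p) _ ?_
  rw [DiscreteGaloisModule.mem_unramifiedSubgroup_iff]
  have h := (DiscreteGaloisModule.mem_unramifiedSubgroup_iff _ 1 z).mp hz
  have h2 := galoisCohomology.res_map_one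
    (IsNonarchimedeanLocalField.maxUnramified ((w : HeightOneSpectrum (𝓞 K')).adicCompletion K'))
    ((dualKappaInv ρ).restrictField ((w : HeightOneSpectrum (𝓞 K')).adicCompletion K')) z
  rw [h, map_zero] at h2
  exact h2

end Dual

end Summit.BirchSwinnertonDyer.BirchSwinnertonDyer.Theorems.KolyvaginRoadThreePT

end
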